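import Literature.NumberTheory.Automorphic.ArchRankOneSplitOrbitContinuityParam   -- ★ p850511 (F0P3b-p01 (g15)) PARAM-JOINT: `continuous_integral_prod_conj_hypBlockGL_half_param`; brings ★ p850189∕p850218 (A0-b) (`abs_sub_smul_integral_descConj_hypBlockGL_eq_smul_integral_prod`, `hypBlockGL_mem_of_eq_over`)
import Literature.NumberTheory.Automorphic.ArchRankOneJumpZeroCone                -- ★ p850353 (F0P3a-p07 (g16)): `isClosedEmbedding_coe_unitaryGroupOfForm_of_eq_over` (`U(J) ↪ M₂(ℂ)` closed embedding)
import Literature.MeasureTheory.Group.QuotientOrbitalIntegralProperSmooth          -- brings the Hörmander engine ★ `Literature.Analysis.Calculus.contDiffAt_integral_comp_of_contDiff_of_support`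
import HarnessLib

/-!
# (A0-smooth): the normalised SPLIT-torus orbital integral of `U(Φ₂)(ℂ)` is `C^∞` ACROSS the real wall `x = 0`, jointly in a smooth parameter
# (Harish-Chandra: `F_f^A ∈ C^∞(A)` on the split Cartan — no jump there; Varadarajan 1989 §6.4; Rogawski 1990 §8.2; Shelstad 1979 Lemma 4.3)

Topic `NumberTheory/Automorphic`; namespace `Literature.NumberTheory.Automorphic.UnitaryGroup`.  THEOREMS ONLY (no `def`, no instance, no notation, no axiom, no named fact,
no `sorry`).  Cell `pub/hodgecm-mathlib`, crux H413 (`stmt-HodgeConjecture-24833`), line LH3 (closer stub `stub_N9`, direct road), LETTER L1 `HcOrbitalFamiliesStatement`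
clause (I₂) at the REAL WALLS `x_w = 0` of the split places — the rank-one ENGINE, all orders (seat F0P3a-p05 (g20), lineage currency ★ p850189∕p850218; the `C^∞` upgrade of
★ p850511 PARAM-JOINT (F0P3b-p01 (g15)), whose ORDER-0 (continuity) statements are the input of the (B) real-wall dress; this file is the input of a later all-orders dress).
Count-neutral.

THE MATHEMATICS.  `G = U(J)(ℂ) ≅ U(1,1)`, `J = (StdForm.antidiagonal 2).over ℂ`, `T = torusU` the SPLIT torus (`hypBlockGL x θ = diag(e^{x+iθ}, e^{−x+iθ})`), `N = unipotentU`,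
`K` a compact subgroup with `G = K · T · N` and `μ = C • ((k,n) ↦ knT)_*(κ ⊗ μ_N)` the invariant measure on `G ⧸ T` in Iwasawa form (★ (IWA)∕FILE 1).  For `x ≠ 0` ★ p850189
proved **`|eˣ − e⁻ˣ| • ∫_{G⧸T} F(y · hypBlockGL x θ · y⁻¹) dμ = C • ∫_{K×N} F(k · e^{iθ} a(x∕2) n a(x∕2) · k⁻¹) d(κ ⊗ μ_N)`**, `a(s) = hypBlockGL s 0` (the Jacobian
`|1 − e^{−2x}|` of `n ↦ a⁻¹ n a n⁻¹` against `|eˣ − e⁻ˣ|`).  The RIGHT side makes sense at `x = 0` and is `C^∞` in `(x, θ)` — and jointly in a parameter `q` when `F_q = f(q, ↑↑·)` for a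
smooth ambient `f : Q × M₂(ℂ) → E` — because locally the integrand is supported in a FIXED compact part of `K × N` and is the smooth function
`f(q, A · hyp(0,θ) hyp(x∕2,0) · B · hyp(x∕2,0) · C)` of the continuous datum `(A, B, C) = (↑↑k, ↑↑n, ↑↑k⁻¹)` (Hörmander ★ `contDiffAt_integral_comp_of_contDiff_of_support`):
* §1 `contDiff_coe_hypBlockGL` — the split torus element is smooth in matrix currency;
* §2 **`contDiff_integral_prod_conj_hypBlockGL_half_param`** (`C^∞` of the chart integral on `Q × ℝ × ℝ`; tokens of ★ p850511 §1 with `Continuous ↦ ContDiff ℝ ∞`) and the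
  parameter-free `contDiff_integral_prod_conj_hypBlockGL_half_of_contDiff`;
* §3 **`exists_contDiff_abs_sub_smul_integral_descConj_hypBlockGL_eq_param`** — `∃ G ∈ C^∞(Q × ℝ × ℝ)` with `|eˣ−e⁻ˣ| • Φ^T_{F_q}(hyp(x,θ)) = G(q,x,θ)` for `x ≠ 0` and
  `G(q,0,θ) = C • ∫_{K×N} F_q(e^{iθ} k n k⁻¹)` (the (A0) value ★ p850511 §2); **`contDiffOn_abs_sub_smul_integral_descConj_hypBlockGL_param`** (`C^∞` on `{x ≠ 0}`);
  the parameter-free `exists_contDiff_abs_sub_smul_integral_descConj_hypBlockGL_eq` — **`F_f^A ∈ C^∞(A)`: NO JUMP ON THE SPLIT CARTAN** (Harish-Chandra's jumps are the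
  COMPACT Cartan's at its noncompact walls — organ J).
HONEST LABEL: this is the rank-one engine only; the multi-place dress «`ContDiffOn ℝ ∞ (orbFamGExt …) (InRegG s S′)` ACROSS the real walls» needs in addition the descent to
the centraliser at the wall point with a SMOOTH descended function `(a′)_M^β` in ambient currency ((aM-SMOOTH)), the (M-UNFOLD) chart reading near the wall, and ★ p850444 §1 — not
here.  HC_CM is proved only modulo the printed citations (2 remaining named inputs: hLiu418 = `stmt-HodgeConjecture-24832`, h413 = `stmt-HodgeConjecture-24833`) until rung 0
closes; count-neutral.

## References
* [Varadarajan1989] V. S. Varadarajan, *An Introduction to Harmonic Analysis on Semisimple Lie Groups*, Cambridge Stud. Adv. Math. 16 (1989), §6.4 Lemma 21, Thm 23 (`F_f` on the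
  split Cartan of `SL(2, ℝ)`: smooth, the Abel-transform form).
* [Rogawski1990] J. D. Rogawski, *Automorphic Representations of Unitary Groups in Three Variables*, Ann. of Math. Stud. 123 (1990), §3.6 p. 31, §8.2 pp. 119–122, §8.3 pp. 122–124.
* [Shelstad1979] D. Shelstad, *Characters and inner forms of a quasi-split group over ℝ*, Compositio Math. 39 (1979), Lemma 4.3 p. 25; §4 pp. 22–24.
* [HormanderALPDO1] L. Hörmander, *The Analysis of Linear Partial Differential Operators I* (1990), Thm. 1.1.9.
* [Knapp1986] A. W. Knapp, *Representation Theory of Semisimple Groups* (1986), Ch. V §3; Ch. XI §7 (`F_f` on noncompact Cartans).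
-/

set_option autoImplicit false

noncomputable section

open MeasureTheory MeasureTheory.Measure Set Filter Topology Complex
open Literature.MeasureTheory.Group
open scoped MatrixGroups ContDiff NNReal
open scoped Matrix.Norms.Operator

namespace Literature.NumberTheory.Automorphic

namespace UnitaryGroup

open Literature.NumberTheory.Automorphic.UnitaryGroup.HeisRing Literature.NumberTheory.Automorphic.UnitaryGroup.LineRing

/-! ## §1 The split torus element is smooth in matrix currency -/

section Chart

/-- **`(x, θ) ↦ hypBlockGL x θ ∈ M₂(ℂ)` is `C^∞`** (entries `e^{±x+iθ}`, `0`; through the linear `Matrix.of`). [cite: Rogawski1990, §3.6 p. 31] [cite: Knapp1986, Ch. V §3] -/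
theorem contDiff_coe_hypBlockGL : ContDiff ℝ ∞ fun p : ℝ × ℝ => ((hypBlockGL p.1 p.2 : GL (Fin 2) ℂ) : Matrix (Fin 2) (Fin 2) ℂ) := by
  let Λ : (Fin 2 → Fin 2 → ℂ) →L[ℝ] Matrix (Fin 2) (Fin 2) ℂ :=
    LinearMap.toContinuousLinearMap (Matrix.ofLinearEquiv ℝ : (Fin 2 → Fin 2 → ℂ) ≃ₗ[ℝ] Matrix (Fin 2) (Fin 2) ℂ).toLinearMap
  have hΛ : ∀ f : Fin 2 → Fin 2 → ℂ, Λ f = Matrix.of f := fun _ => rfl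
  have hfun : (fun p : ℝ × ℝ => ((hypBlockGL p.1 p.2 : GL (Fin 2) ℂ) : Matrix (Fin 2) (Fin 2) ℂ)) =
      fun p => Λ fun i j => ((hypBlockGL p.1 p.2 : GL (Fin 2) ℂ) : Matrix (Fin 2) (Fin 2) ℂ) i j := by
    funext p; rw [hΛ]; rfl
  rw [hfun]
  refine Λ.contDiff.comp (contDiff_pi.2 fun i => contDiff_pi.2 fun j => ?_)
  have h1 : ContDiff ℝ ∞ fun p : ℝ × ℝ => ((p.1 : ℝ) : ℂ) := ofRealCLM.contDiff.comp contDiff_fst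
  have h2 : ContDiff ℝ ∞ fun p : ℝ × ℝ => ((p.2 : ℝ) : ℂ) := ofRealCLM.contDiff.comp contDiff_snd
  have hePlus : ContDiff ℝ ∞ fun p : ℝ × ℝ => Complex.exp ((p.1 : ℂ) + (p.2 : ℂ) * I) := Complex.contDiff_exp.comp (h1.add (h2.mul contDiff_const))
  have heMinus : ContDiff ℝ ∞ fun p : ℝ × ℝ => Complex.exp (-(p.1 : ℂ) + (p.2 : ℂ) * I) := Complex.contDiff_exp.comp (h1.neg.add (h2.mul contDiff_const))
  have h0 : ContDiff ℝ ∞ fun _ : ℝ × ℝ => (0 : ℂ) := contDiff_const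
  simp only [coe_hypBlockGL]
  fin_cases i <;> fin_cases j
  · simpa using hePlus
  · simpa using h0
  · simpa using h0
  · simpa using heMinus

end Chart

/-! ## §2 The chart integral `∫_{K × N} F_q(k · e^{iθ} a(x∕2) n a(x∕2) · k⁻¹)` is `C^∞` in `(q, x, θ)` -/

section Smooth

variable {J : Matrix (Fin 2) (Fin 2) ℂ} (hJ : J = (StdForm.antidiagonal 2).over ℂ)
  [MeasurableSpace ↥(unitaryGroupOfForm (starRingEnd ℂ) J)] [BorelSpace ↥(unitaryGroupOfForm (starRingEnd ℂ) J)]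
  {K : Subgroup ↥(unitaryGroupOfForm (starRingEnd ℂ) J)} (κ : Measure ↥K)
  (μN : Measure ↥(unipotentU (starRingEnd ℂ) J)) {E : Type*} [NormedAddCommGroup E] [NormedSpace ℝ E] [CompleteSpace E]
  {Q : Type*} [NormedAddCommGroup Q] [NormedSpace ℝ Q] [FiniteDimensional ℝ Q]

include hJ in
/-- **(A0-smooth), JOINT `C^∞` OF THE CHART INTEGRAL in `(q, x, θ)`.**  For `K` compact, `κ`, `μ_N` Haar, a parametrised test function `F : Q → U(J) → E` read through a SMOOTH
ambient function `f : Q × M₂(ℂ) → E` (`F q g = f (q, ↑↑g)`) with all `F_q` supported in one compact `S₀`: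
**`(q, x, θ) ↦ ∫_{K × N} F_q(k · (hypBlockGL 0 θ · a(x) n a(x)) · k⁻¹) d(κ ⊗ μ_N)`**, `a(x) = hypBlockGL (x∕2) 0`, is `C^∞` on `Q × ℝ × ℝ` — THROUGH `x = 0`.  Proof:
locally in `(q, x, θ)` the integrand is supported in a FIXED compact subset of `K × N` (exactly as in ★ `continuous_integral_prod_conj_hypBlockGL_half_param`), and it is the smooth
`Ψ((A, B, C), (q, x, θ)) = f(q, A · hyp(0,θ) hyp(x∕2,0) · B · hyp(x∕2,0) · C)` read at the continuous datum `(↑↑k, ↑↑n, ↑↑k⁻¹)`, so the Hörmander engine ★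
`contDiffAt_integral_comp_of_contDiff_of_support` applies.  The `C^∞` upgrade of ★ p850511 §1. [cite: Varadarajan1989, §6.4 Thm 23] [cite: Shelstad1979, Lemma 4.3 p. 25]
[cite: HormanderALPDO1, Thm. 1.1.9] -/
theorem contDiff_integral_prod_conj_hypBlockGL_half_param (hK : IsCompact (K : Set ↥(unitaryGroupOfForm (starRingEnd ℂ) J)))
    [IsHaarMeasure κ] [IsHaarMeasure μN] (F : Q → ↥(unitaryGroupOfForm (starRingEnd ℂ) J) → E)
    (f : Q × Matrix (Fin 2) (Fin 2) ℂ → E) (hf : ContDiff ℝ ∞ f) (hFf : ∀ q g, F q g = f (q, ((g : GL (Fin 2) ℂ) : Matrix (Fin 2) (Fin 2) ℂ)))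
    {S₀ : Set ↥(unitaryGroupOfForm (starRingEnd ℂ) J)} (hS₀ : IsCompact S₀) (hFS : ∀ q g, g ∉ S₀ → F q g = 0) :
    ContDiff ℝ ∞ fun qxθ : Q × ℝ × ℝ => ∫ p : ↥K × ↥(unipotentU (starRingEnd ℂ) J),
        F qxθ.1 ((p.1 : ↥(unitaryGroupOfForm (starRingEnd ℂ) J)) *
          ((⟨hypBlockGL 0 qxθ.2.2, hypBlockGL_mem_of_eq_over hJ 0 qxθ.2.2⟩ : ↥(unitaryGroupOfForm (starRingEnd ℂ) J)) *
            (⟨hypBlockGL (qxθ.2.1 / 2) 0, hypBlockGL_mem_of_eq_over hJ (qxθ.2.1 / 2) 0⟩ : ↥(unitaryGroupOfForm (starRingEnd ℂ) J)) *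
            (p.2 : ↥(unitaryGroupOfForm (starRingEnd ℂ) J)) *
            (⟨hypBlockGL (qxθ.2.1 / 2) 0, hypBlockGL_mem_of_eq_over hJ (qxθ.2.1 / 2) 0⟩ : ↥(unitaryGroupOfForm (starRingEnd ℂ) J))) *
          (p.1 : ↥(unitaryGroupOfForm (starRingEnd ℂ) J))⁻¹) ∂(κ.prod μN) := by
  haveI : LocallyCompactSpace ↥(unitaryGroupOfForm (starRingEnd ℂ) J) := locallyCompactSpace_unitaryGroupOfForm_complex J
  haveI : SecondCountableTopology ↥(unitaryGroupOfForm (starRingEnd ℂ) J) := secondCountableTopology_unitaryGroupOfForm_complex J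
  have hN : IsClosed (unipotentU (starRingEnd ℂ) J : Set ↥(unitaryGroupOfForm (starRingEnd ℂ) J)) := isClosed_unipotentU _ _
  haveI : LocallyCompactSpace ↥(unipotentU (starRingEnd ℂ) J) := hN.isClosedEmbedding_subtypeVal.locallyCompactSpace
  haveI : SecondCountableTopology ↥(unipotentU (starRingEnd ℂ) J) := TopologicalSpace.Subtype.secondCountableTopology _
  haveI : SecondCountableTopology ↥K := TopologicalSpace.Subtype.secondCountableTopology _
  haveI : BorelSpace ↥(unipotentU (starRingEnd ℂ) J) := Subtype.borelSpace _
  haveI : BorelSpace ↥K := Subtype.borelSpace _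
  haveI : BorelSpace (↥K × ↥(unipotentU (starRingEnd ℂ) J)) := Prod.borelSpace
  haveI : CompactSpace ↥K := isCompact_iff_compactSpace.1 hK
  haveI : LocallyCompactSpace ↥K := hK.isClosed.isClosedEmbedding_subtypeVal.locallyCompactSpace
  -- the moving torus element `a(x)` and the moving centre `z(θ)`
  obtain ⟨z, hz⟩ : ∃ z : Q × ℝ × ℝ → ↥(unitaryGroupOfForm (starRingEnd ℂ) J),
      z = fun qxθ => ⟨hypBlockGL 0 qxθ.2.2, hypBlockGL_mem_of_eq_over hJ 0 qxθ.2.2⟩ := ⟨_, rfl⟩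
  obtain ⟨a, ha⟩ : ∃ a : Q × ℝ × ℝ → ↥(unitaryGroupOfForm (starRingEnd ℂ) J),
      a = fun qxθ => ⟨hypBlockGL (qxθ.2.1 / 2) 0, hypBlockGL_mem_of_eq_over hJ (qxθ.2.1 / 2) 0⟩ := ⟨_, rfl⟩
  have hzc : Continuous z := by
    rw [hz]
    exact (continuous_hypBlockGL.comp (continuous_const.prodMk (continuous_snd.comp continuous_snd))).subtype_mk _
  have hac : Continuous a := by
    rw [ha]
    exact (continuous_hypBlockGL.comp (((continuous_fst.comp continuous_snd).div_const 2).prodMk continuous_const)).subtype_mk _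
  -- matrix currency: the smooth maps `qxθ ↦ ↑↑(z qxθ)`, `qxθ ↦ ↑↑(a qxθ)`
  have hzs : ContDiff ℝ ∞ fun qxθ : Q × ℝ × ℝ => (((z qxθ : ↥(unitaryGroupOfForm (starRingEnd ℂ) J)) : GL (Fin 2) ℂ) : Matrix (Fin 2) (Fin 2) ℂ) := by
    rw [hz]
    exact contDiff_coe_hypBlockGL.comp (contDiff_const.prodMk (contDiff_snd.comp contDiff_snd))
  have has : ContDiff ℝ ∞ fun qxθ : Q × ℝ × ℝ => (((a qxθ : ↥(unitaryGroupOfForm (starRingEnd ℂ) J)) : GL (Fin 2) ℂ) : Matrix (Fin 2) (Fin 2) ℂ) := by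
    rw [ha]
    exact contDiff_coe_hypBlockGL.comp (((contDiff_fst.comp contDiff_snd).div_const 2).prodMk contDiff_const)
  -- the integrand as a function of `(qxθ, p)`
  obtain ⟨g, hg⟩ : ∃ g : Q × ℝ × ℝ → ↥K × ↥(unipotentU (starRingEnd ℂ) J) → E, g = fun qxθ p =>
      F qxθ.1 ((p.1 : ↥(unitaryGroupOfForm (starRingEnd ℂ) J)) * (z qxθ * a qxθ * (p.2 : ↥(unitaryGroupOfForm (starRingEnd ℂ) J)) * a qxθ) *
        (p.1 : ↥(unitaryGroupOfForm (starRingEnd ℂ) J))⁻¹) := ⟨_, rfl⟩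
  have hgoal : (fun qxθ : Q × ℝ × ℝ => ∫ p : ↥K × ↥(unipotentU (starRingEnd ℂ) J),
        F qxθ.1 ((p.1 : ↥(unitaryGroupOfForm (starRingEnd ℂ) J)) *
          ((⟨hypBlockGL 0 qxθ.2.2, hypBlockGL_mem_of_eq_over hJ 0 qxθ.2.2⟩ : ↥(unitaryGroupOfForm (starRingEnd ℂ) J)) *
            (⟨hypBlockGL (qxθ.2.1 / 2) 0, hypBlockGL_mem_of_eq_over hJ (qxθ.2.1 / 2) 0⟩ : ↥(unitaryGroupOfForm (starRingEnd ℂ) J)) *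
            (p.2 : ↥(unitaryGroupOfForm (starRingEnd ℂ) J)) *
            (⟨hypBlockGL (qxθ.2.1 / 2) 0, hypBlockGL_mem_of_eq_over hJ (qxθ.2.1 / 2) 0⟩ : ↥(unitaryGroupOfForm (starRingEnd ℂ) J))) *
          (p.1 : ↥(unitaryGroupOfForm (starRingEnd ℂ) J))⁻¹) ∂(κ.prod μN)) = fun qxθ => ∫ p, g qxθ p ∂(κ.prod μN) := by
    rw [hg, ha, hz]
  rw [hgoal]
  -- the smooth factorisation `g qxθ (k, n) = Ψ ((↑↑k, ↑↑n, ↑↑k⁻¹), qxθ)`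
  let P3 := Matrix (Fin 2) (Fin 2) ℂ × Matrix (Fin 2) (Fin 2) ℂ × Matrix (Fin 2) (Fin 2) ℂ
  obtain ⟨Ψ, hΨ⟩ : ∃ Ψ : P3 × (Q × ℝ × ℝ) → E, Ψ = fun w =>
      f (w.2.1, w.1.1 * ((((z w.2 : ↥(unitaryGroupOfForm (starRingEnd ℂ) J)) : GL (Fin 2) ℂ) : Matrix (Fin 2) (Fin 2) ℂ) *
        (((a w.2 : ↥(unitaryGroupOfForm (starRingEnd ℂ) J)) : GL (Fin 2) ℂ) : Matrix (Fin 2) (Fin 2) ℂ) * w.1.2.1 *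
        (((a w.2 : ↥(unitaryGroupOfForm (starRingEnd ℂ) J)) : GL (Fin 2) ℂ) : Matrix (Fin 2) (Fin 2) ℂ)) * w.1.2.2) := ⟨_, rfl⟩
  have hΨs : ContDiff ℝ ∞ Ψ := by
    rw [hΨ]
    refine hf.comp ((contDiff_fst.comp contDiff_snd).prodMk ?_)
    have hA : ContDiff ℝ ∞ fun w : P3 × (Q × ℝ × ℝ) => w.1.1 := contDiff_fst.comp contDiff_fst
    have hB : ContDiff ℝ ∞ fun w : P3 × (Q × ℝ × ℝ) => w.1.2.1 := contDiff_fst.comp (contDiff_snd.comp contDiff_fst)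
    have hC : ContDiff ℝ ∞ fun w : P3 × (Q × ℝ × ℝ) => w.1.2.2 := contDiff_snd.comp (contDiff_snd.comp contDiff_fst)
    have hz' := hzs.comp (contDiff_snd (E := P3) (F := Q × ℝ × ℝ))
    have ha' := has.comp (contDiff_snd (E := P3) (F := Q × ℝ × ℝ))
    exact (hA.mul (((hz'.mul ha').mul hB).mul ha')).mul hC
  obtain ⟨y, hy⟩ : ∃ y : ↥K × ↥(unipotentU (starRingEnd ℂ) J) → P3, y = fun p =>
      ((((p.1 : ↥(unitaryGroupOfForm (starRingEnd ℂ) J)) : GL (Fin 2) ℂ) : Matrix (Fin 2) (Fin 2) ℂ),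
        ((((p.2 : ↥(unitaryGroupOfForm (starRingEnd ℂ) J)) : GL (Fin 2) ℂ) : Matrix (Fin 2) (Fin 2) ℂ),
          ((((p.1 : ↥(unitaryGroupOfForm (starRingEnd ℂ) J))⁻¹ : ↥(unitaryGroupOfForm (starRingEnd ℂ) J)) : GL (Fin 2) ℂ) : Matrix (Fin 2) (Fin 2) ℂ))) := ⟨_, rfl⟩
  have hcoe : Continuous fun u : ↥(unitaryGroupOfForm (starRingEnd ℂ) J) => ((u : GL (Fin 2) ℂ) : Matrix (Fin 2) (Fin 2) ℂ) :=
    Units.continuous_val.comp continuous_subtype_val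
  have hyc : Continuous y := by
    rw [hy]
    exact (hcoe.comp (continuous_subtype_val.comp continuous_fst)).prodMk
      ((hcoe.comp (continuous_subtype_val.comp continuous_snd)).prodMk (hcoe.comp ((continuous_subtype_val.comp continuous_fst).inv)))
  have hfac : ∀ qxθ p, g qxθ p = Ψ (y p, qxθ) := by
    intro qxθ p
    rw [hg, hΨ, hy]
    simp only [hFf, Subgroup.coe_mul, Units.val_mul]
  have hgoal' : (fun qxθ => ∫ p, g qxθ p ∂(κ.prod μN)) = fun qxθ => ∫ p, Ψ (y p, qxθ) ∂(κ.prod μN) := by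
    funext qxθ
    exact integral_congr_ae (Filter.Eventually.of_forall fun p => hfac qxθ p)
  rw [hgoal']
  refine contDiff_iff_contDiffAt.2 fun p₀ => ?_
  -- a compact neighbourhood of `p₀` and a compact set of `K × N` carrying the support there
  obtain ⟨V, hVc, hVn⟩ := exists_compact_mem_nhds p₀
  obtain ⟨Φ, hΦ⟩ : ∃ Φ : (Q × ℝ × ℝ) × ↥K × ↥(unitaryGroupOfForm (starRingEnd ℂ) J) → ↥(unitaryGroupOfForm (starRingEnd ℂ) J),
      Φ = fun q => (z q.1 * a q.1)⁻¹ * (((q.2.1 : ↥K) : ↥(unitaryGroupOfForm (starRingEnd ℂ) J))⁻¹ * q.2.2 *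
        ((q.2.1 : ↥K) : ↥(unitaryGroupOfForm (starRingEnd ℂ) J))) * (a q.1)⁻¹ := ⟨_, rfl⟩
  have hΦc : Continuous Φ := by
    rw [hΦ]
    have h1 : Continuous fun q : (Q × ℝ × ℝ) × ↥K × ↥(unitaryGroupOfForm (starRingEnd ℂ) J) =>
        ((q.2.1 : ↥K) : ↥(unitaryGroupOfForm (starRingEnd ℂ) J)) := continuous_subtype_val.comp (continuous_fst.comp continuous_snd)
    have h3 : Continuous fun q : (Q × ℝ × ℝ) × ↥K × ↥(unitaryGroupOfForm (starRingEnd ℂ) J) => a q.1 := hac.comp continuous_fst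
    have h4 : Continuous fun q : (Q × ℝ × ℝ) × ↥K × ↥(unitaryGroupOfForm (starRingEnd ℂ) J) => z q.1 := hzc.comp continuous_fst
    exact ((h4.mul h3).inv.mul ((h1.inv.mul (continuous_snd.comp continuous_snd)).mul h1)).mul h3.inv
  set S₁ : Set ↥(unitaryGroupOfForm (starRingEnd ℂ) J) := Φ '' (V ×ˢ (univ ×ˢ S₀)) with hS₁
  have hS₁c : IsCompact S₁ := ((hVc.prod (isCompact_univ.prod hS₀)).image hΦc)
  set N₀ : Set ↥(unipotentU (starRingEnd ℂ) J) := Subtype.val ⁻¹' S₁ with hN₀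
  have hN₀c : IsCompact N₀ := hN.isClosedEmbedding_subtypeVal.isCompact_preimage hS₁c
  set s : Set (↥K × ↥(unipotentU (starRingEnd ℂ) J)) := univ ×ˢ N₀ with hs
  have hsc : IsCompact s := isCompact_univ.prod hN₀c
  -- off `s` the integrand vanishes, for `qxθ ∈ V`
  have hzero : ∀ p, p ∉ s → ∀ qxθ ∈ V, Ψ (y p, qxθ) = 0 := by
    intro p hp qxθ hx
    rw [← hfac, hg]
    by_contra hne
    apply hp
    refine mk_mem_prod (mem_univ _) ?_
    change ((p.2 : ↥(unipotentU (starRingEnd ℂ) J)) : ↥(unitaryGroupOfForm (starRingEnd ℂ) J)) ∈ S₁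
    have hmem : (p.1 : ↥(unitaryGroupOfForm (starRingEnd ℂ) J)) * (z qxθ * a qxθ * (p.2 : ↥(unitaryGroupOfForm (starRingEnd ℂ) J)) * a qxθ) *
        (p.1 : ↥(unitaryGroupOfForm (starRingEnd ℂ) J))⁻¹ ∈ S₀ := by
      by_contra hout
      exact hne (hFS qxθ.1 _ hout)
    refine ⟨(qxθ, p.1, (p.1 : ↥(unitaryGroupOfForm (starRingEnd ℂ) J)) * (z qxθ * a qxθ * (p.2 : ↥(unitaryGroupOfForm (starRingEnd ℂ) J)) * a qxθ) *
      (p.1 : ↥(unitaryGroupOfForm (starRingEnd ℂ) J))⁻¹), mk_mem_prod hx (mk_mem_prod (mem_univ _) hmem), ?_⟩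
    rw [hΦ]
    simp only
    group
  exact Literature.Analysis.Calculus.contDiffAt_integral_comp_of_contDiff_of_support (κ.prod μN) Ψ hΨs y hyc p₀ hsc hVn hzero


include hJ in
/-- **(A0-smooth) without parameter**: for ONE test function `F = f ∘ (↑↑·)` with `f` smooth on `M₂(ℂ)` and `F` compactly supported,
`(x, θ) ↦ ∫_{K × N} F(k · (hypBlockGL 0 θ · a(x) n a(x)) · k⁻¹) d(κ ⊗ μ_N)` is `C^∞` on `ℝ × ℝ`. [cite: Varadarajan1989, §6.4 Thm 23] [cite: Shelstad1979, Lemma 4.3 p. 25] -/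
theorem contDiff_integral_prod_conj_hypBlockGL_half_of_contDiff (hK : IsCompact (K : Set ↥(unitaryGroupOfForm (starRingEnd ℂ) J)))
    [IsHaarMeasure κ] [IsHaarMeasure μN] (F : ↥(unitaryGroupOfForm (starRingEnd ℂ) J) → E)
    (f : Matrix (Fin 2) (Fin 2) ℂ → E) (hf : ContDiff ℝ ∞ f) (hFf : ∀ g, F g = f ((g : GL (Fin 2) ℂ) : Matrix (Fin 2) (Fin 2) ℂ)) (hFc : HasCompactSupport F) :
    ContDiff ℝ ∞ fun xθ : ℝ × ℝ => ∫ p : ↥K × ↥(unipotentU (starRingEnd ℂ) J),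
        F ((p.1 : ↥(unitaryGroupOfForm (starRingEnd ℂ) J)) *
          ((⟨hypBlockGL 0 xθ.2, hypBlockGL_mem_of_eq_over hJ 0 xθ.2⟩ : ↥(unitaryGroupOfForm (starRingEnd ℂ) J)) *
            (⟨hypBlockGL (xθ.1 / 2) 0, hypBlockGL_mem_of_eq_over hJ (xθ.1 / 2) 0⟩ : ↥(unitaryGroupOfForm (starRingEnd ℂ) J)) *
            (p.2 : ↥(unitaryGroupOfForm (starRingEnd ℂ) J)) *
            (⟨hypBlockGL (xθ.1 / 2) 0, hypBlockGL_mem_of_eq_over hJ (xθ.1 / 2) 0⟩ : ↥(unitaryGroupOfForm (starRingEnd ℂ) J))) *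
          (p.1 : ↥(unitaryGroupOfForm (starRingEnd ℂ) J))⁻¹) ∂(κ.prod μN) := by
  have h := contDiff_integral_prod_conj_hypBlockGL_half_param hJ κ μN (Q := ℝ) hK (fun _ : ℝ => F) (fun w => f w.2) (hf.comp contDiff_snd)
    (fun _ g => hFf g) hFc.isCompact (fun _ g hg => image_eq_zero_of_notMem_tsupport hg)
  have hι : ContDiff ℝ ∞ fun xθ : ℝ × ℝ => ((0 : ℝ), xθ) := contDiff_const.prodMk contDiff_id
  have h' := h.comp hι
  simpa only [Function.comp_def] using h'

/-! ## §3 The normalised split functional `|eˣ − e⁻ˣ| • Φ^T` is `C^∞` off the wall and EXTENDS `C^∞` ACROSS it -/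

variable [MeasurableSpace (↥(unitaryGroupOfForm (starRingEnd ℂ) J) ⧸ torusU (starRingEnd ℂ) J)]
  [BorelSpace (↥(unitaryGroupOfForm (starRingEnd ℂ) J) ⧸ torusU (starRingEnd ℂ) J)]
  (μ : Measure (↥(unitaryGroupOfForm (starRingEnd ℂ) J) ⧸ torusU (starRingEnd ℂ) J))

include hJ in
/-- **(A0-smooth) HEAD — `F_f^A ∈ C^∞(A)`: THE NORMALISED SPLIT-TORUS ORBITAL INTEGRAL EXTENDS SMOOTHLY ACROSS THE REAL WALL, JOINTLY IN A SMOOTH PARAMETER.**  With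
`μ = C • ((k, n) ↦ k n T)_*(κ ⊗ μ_N)` on `U(Φ₂)(ℂ) ⧸ T` (★ `exists_measure_quotient_torusU_complex_two_eq_smul_map`), `K` compact, `F : Q → U(J) → E` read through a smooth
ambient `f : Q × M₂(ℂ) → E` with all `F_q` supported in one compact `S₀`: there is a `C^∞` function `G` on `Q × ℝ × ℝ` with
**`|eˣ − e⁻ˣ| • ∫_{G ⧸ T} F_q(y · hypBlockGL x θ · y⁻¹) dμ(y) = G (q, x, θ)` for every `x ≠ 0`** and **`G (q, 0, θ) = C • ∫_{K × N} F_q(e^{iθ} · k n k⁻¹) d(κ ⊗ μ_N)`**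
(the (A0) value ★ `tendsto_abs_sub_smul_integral_descConj_hypBlockGL_param`).  `G` is `C •` the chart integral of §2 (★ p850189
`abs_sub_smul_integral_descConj_hypBlockGL_eq_smul_integral_prod` off the wall, ★ `integral_prod_conj_hypBlockGL_half_zero` on it).  There is NO jump on the split Cartan:
Harish-Chandra's jump relations live on the noncompact walls of the COMPACT Cartan (organ J). [cite: Varadarajan1989, §6.4 Lemma 21, Thm 23] [cite: Rogawski1990, §8.2 pp. 119–122]
[cite: Shelstad1979, Lemma 4.3 p. 25] [cite: HormanderALPDO1, Thm. 1.1.9] -/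
theorem exists_contDiff_abs_sub_smul_integral_descConj_hypBlockGL_eq_param (hK : IsCompact (K : Set ↥(unitaryGroupOfForm (starRingEnd ℂ) J)))
    [IsHaarMeasure κ] [IsHaarMeasure μN] {C : ℝ≥0}
    (hμC : μ = C • Measure.map
      (fun p : ↥K × ↥(unipotentU (starRingEnd ℂ) J) =>
        (QuotientGroup.mk ((p.1 : ↥(unitaryGroupOfForm (starRingEnd ℂ) J)) * (p.2 : ↥(unitaryGroupOfForm (starRingEnd ℂ) J))) :
          ↥(unitaryGroupOfForm (starRingEnd ℂ) J) ⧸ torusU (starRingEnd ℂ) J))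
      (κ.prod μN))
    (F : Q → ↥(unitaryGroupOfForm (starRingEnd ℂ) J) → E)
    (f : Q × Matrix (Fin 2) (Fin 2) ℂ → E) (hf : ContDiff ℝ ∞ f) (hFf : ∀ q g, F q g = f (q, ((g : GL (Fin 2) ℂ) : Matrix (Fin 2) (Fin 2) ℂ)))
    {S₀ : Set ↥(unitaryGroupOfForm (starRingEnd ℂ) J)} (hS₀ : IsCompact S₀) (hFS : ∀ q g, g ∉ S₀ → F q g = 0) :
    ∃ G : Q × ℝ × ℝ → E, ContDiff ℝ ∞ G ∧
      (∀ qxθ : Q × ℝ × ℝ, qxθ.2.1 ≠ 0 →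
        |Real.exp qxθ.2.1 - Real.exp (-qxθ.2.1)| •
          ∫ y, descConj (⟨hypBlockGL qxθ.2.1 qxθ.2.2, hypBlockGL_mem_of_eq_over hJ qxθ.2.1 qxθ.2.2⟩ : ↥(unitaryGroupOfForm (starRingEnd ℂ) J))
            (torusU (starRingEnd ℂ) J) (LineRing.forall_mem_torusU_comm (starRingEnd ℂ) J (hypBlockGL_mem_torusU hJ qxθ.2.1 qxθ.2.2)) (F qxθ.1) y ∂μ = G qxθ) ∧
      ∀ (q : Q) (θ : ℝ), G (q, 0, θ) = (C : ℝ) • ∫ p : ↥K × ↥(unipotentU (starRingEnd ℂ) J),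
        F q ((⟨hypBlockGL 0 θ, hypBlockGL_mem_of_eq_over hJ 0 θ⟩ : ↥(unitaryGroupOfForm (starRingEnd ℂ) J)) *
          ((p.1 : ↥(unitaryGroupOfForm (starRingEnd ℂ) J)) * (p.2 : ↥(unitaryGroupOfForm (starRingEnd ℂ) J)) *
            (p.1 : ↥(unitaryGroupOfForm (starRingEnd ℂ) J))⁻¹)) ∂(κ.prod μN) := by
  refine ⟨fun qxθ => (C : ℝ) • ∫ p : ↥K × ↥(unipotentU (starRingEnd ℂ) J),
        F qxθ.1 ((p.1 : ↥(unitaryGroupOfForm (starRingEnd ℂ) J)) *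
          ((⟨hypBlockGL 0 qxθ.2.2, hypBlockGL_mem_of_eq_over hJ 0 qxθ.2.2⟩ : ↥(unitaryGroupOfForm (starRingEnd ℂ) J)) *
            (⟨hypBlockGL (qxθ.2.1 / 2) 0, hypBlockGL_mem_of_eq_over hJ (qxθ.2.1 / 2) 0⟩ : ↥(unitaryGroupOfForm (starRingEnd ℂ) J)) *
            (p.2 : ↥(unitaryGroupOfForm (starRingEnd ℂ) J)) *
            (⟨hypBlockGL (qxθ.2.1 / 2) 0, hypBlockGL_mem_of_eq_over hJ (qxθ.2.1 / 2) 0⟩ : ↥(unitaryGroupOfForm (starRingEnd ℂ) J))) *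
          (p.1 : ↥(unitaryGroupOfForm (starRingEnd ℂ) J))⁻¹) ∂(κ.prod μN),
    (contDiff_integral_prod_conj_hypBlockGL_half_param hJ κ μN hK F f hf hFf hS₀ hFS).const_smul (C : ℝ), fun qxθ hx => ?_, fun q θ => ?_⟩
  · have hFq : Continuous (F qxθ.1) := by
      have e : F qxθ.1 = fun g : ↥(unitaryGroupOfForm (starRingEnd ℂ) J) => f (qxθ.1, ((g : GL (Fin 2) ℂ) : Matrix (Fin 2) (Fin 2) ℂ)) :=
        funext fun g => hFf qxθ.1 g
      rw [e]
      exact hf.continuous.comp (continuous_const.prodMk (Units.continuous_val.comp continuous_subtype_val))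
    haveI : CompactSpace ↥K := isCompact_iff_compactSpace.1 hK
    exact abs_sub_smul_integral_descConj_hypBlockGL_eq_smul_integral_prod hJ κ μN μ hμC (F qxθ.1) hFq qxθ.2.2 hx
  · simp only
    rw [integral_prod_conj_hypBlockGL_half_zero hJ κ μN (F q) θ (K := K) (E := E)]

include hJ in
/-- **Off the wall the normalised split functional IS `C^∞`** (jointly in the smooth parameter): `ContDiffOn ℝ ∞` on `{x ≠ 0}` — the restriction of §3's smooth `G`.
[cite: Varadarajan1989, §6.4 Thm 23] [cite: Rogawski1990, §8.3 pp. 122–124] -/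
theorem contDiffOn_abs_sub_smul_integral_descConj_hypBlockGL_param (hK : IsCompact (K : Set ↥(unitaryGroupOfForm (starRingEnd ℂ) J)))
    [IsHaarMeasure κ] [IsHaarMeasure μN] {C : ℝ≥0}
    (hμC : μ = C • Measure.map
      (fun p : ↥K × ↥(unipotentU (starRingEnd ℂ) J) =>
        (QuotientGroup.mk ((p.1 : ↥(unitaryGroupOfForm (starRingEnd ℂ) J)) * (p.2 : ↥(unitaryGroupOfForm (starRingEnd ℂ) J))) :
          ↥(unitaryGroupOfForm (starRingEnd ℂ) J) ⧸ torusU (starRingEnd ℂ) J))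
      (κ.prod μN))
    (F : Q → ↥(unitaryGroupOfForm (starRingEnd ℂ) J) → E)
    (f : Q × Matrix (Fin 2) (Fin 2) ℂ → E) (hf : ContDiff ℝ ∞ f) (hFf : ∀ q g, F q g = f (q, ((g : GL (Fin 2) ℂ) : Matrix (Fin 2) (Fin 2) ℂ)))
    {S₀ : Set ↥(unitaryGroupOfForm (starRingEnd ℂ) J)} (hS₀ : IsCompact S₀) (hFS : ∀ q g, g ∉ S₀ → F q g = 0) :
    ContDiffOn ℝ ∞ (fun qxθ : Q × ℝ × ℝ => |Real.exp qxθ.2.1 - Real.exp (-qxθ.2.1)| •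
        ∫ y, descConj (⟨hypBlockGL qxθ.2.1 qxθ.2.2, hypBlockGL_mem_of_eq_over hJ qxθ.2.1 qxθ.2.2⟩ : ↥(unitaryGroupOfForm (starRingEnd ℂ) J))
          (torusU (starRingEnd ℂ) J) (LineRing.forall_mem_torusU_comm (starRingEnd ℂ) J (hypBlockGL_mem_torusU hJ qxθ.2.1 qxθ.2.2)) (F qxθ.1) y ∂μ)
      {qxθ : Q × ℝ × ℝ | qxθ.2.1 ≠ 0} := by
  obtain ⟨G, hG, hGeq, -⟩ := exists_contDiff_abs_sub_smul_integral_descConj_hypBlockGL_eq_param hJ κ μN μ hK hμC F f hf hFf hS₀ hFS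
  exact hG.contDiffOn.congr fun qxθ hx => hGeq qxθ hx


include hJ in
/-- **(A0-smooth) HEAD without parameter**: for ONE test function `F = f ∘ (↑↑·)` (`f` smooth on `M₂(ℂ)`, `F` compactly supported) there is a `C^∞` function `G` on `ℝ × ℝ` with
`|eˣ − e⁻ˣ| • ∫_{G ⧸ T} F(y · hypBlockGL x θ · y⁻¹) dμ = G (x, θ)` for `x ≠ 0` and `G (0, θ) = C • ∫_{K × N} F(e^{iθ} · k n k⁻¹)` — `F_f^A ∈ C^∞(A)`.
[cite: Varadarajan1989, §6.4 Lemma 21, Thm 23] [cite: Rogawski1990, §8.2 pp. 119–122] [cite: Shelstad1979, Lemma 4.3 p. 25] -/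
theorem exists_contDiff_abs_sub_smul_integral_descConj_hypBlockGL_eq (hK : IsCompact (K : Set ↥(unitaryGroupOfForm (starRingEnd ℂ) J)))
    [IsHaarMeasure κ] [IsHaarMeasure μN] {C : ℝ≥0}
    (hμC : μ = C • Measure.map
      (fun p : ↥K × ↥(unipotentU (starRingEnd ℂ) J) =>
        (QuotientGroup.mk ((p.1 : ↥(unitaryGroupOfForm (starRingEnd ℂ) J)) * (p.2 : ↥(unitaryGroupOfForm (starRingEnd ℂ) J))) :
          ↥(unitaryGroupOfForm (starRingEnd ℂ) J) ⧸ torusU (starRingEnd ℂ) J))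
      (κ.prod μN))
    (F : ↥(unitaryGroupOfForm (starRingEnd ℂ) J) → E)
    (f : Matrix (Fin 2) (Fin 2) ℂ → E) (hf : ContDiff ℝ ∞ f) (hFf : ∀ g, F g = f ((g : GL (Fin 2) ℂ) : Matrix (Fin 2) (Fin 2) ℂ)) (hFc : HasCompactSupport F) :
    ∃ G : ℝ × ℝ → E, ContDiff ℝ ∞ G ∧
      (∀ xθ : ℝ × ℝ, xθ.1 ≠ 0 →
        |Real.exp xθ.1 - Real.exp (-xθ.1)| •
          ∫ y, descConj (⟨hypBlockGL xθ.1 xθ.2, hypBlockGL_mem_of_eq_over hJ xθ.1 xθ.2⟩ : ↥(unitaryGroupOfForm (starRingEnd ℂ) J))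
            (torusU (starRingEnd ℂ) J) (LineRing.forall_mem_torusU_comm (starRingEnd ℂ) J (hypBlockGL_mem_torusU hJ xθ.1 xθ.2)) F y ∂μ = G xθ) ∧
      ∀ θ : ℝ, G (0, θ) = (C : ℝ) • ∫ p : ↥K × ↥(unipotentU (starRingEnd ℂ) J),
        F ((⟨hypBlockGL 0 θ, hypBlockGL_mem_of_eq_over hJ 0 θ⟩ : ↥(unitaryGroupOfForm (starRingEnd ℂ) J)) *
          ((p.1 : ↥(unitaryGroupOfForm (starRingEnd ℂ) J)) * (p.2 : ↥(unitaryGroupOfForm (starRingEnd ℂ) J)) *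
            (p.1 : ↥(unitaryGroupOfForm (starRingEnd ℂ) J))⁻¹)) ∂(κ.prod μN) := by
  obtain ⟨G, hG, hGeq, hG0⟩ := exists_contDiff_abs_sub_smul_integral_descConj_hypBlockGL_eq_param hJ κ μN μ (Q := ℝ) hK hμC (fun _ : ℝ => F)
    (fun w => f w.2) (hf.comp contDiff_snd) (fun _ g => hFf g) hFc.isCompact (fun _ g hg => image_eq_zero_of_notMem_tsupport hg)
  have hι : ContDiff ℝ ∞ fun xθ : ℝ × ℝ => ((0 : ℝ), xθ) := contDiff_const.prodMk contDiff_id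
  exact ⟨fun xθ => G (0, xθ), hG.comp hι, fun xθ hx => hGeq (0, xθ) hx, fun θ => hG0 0 θ⟩

end Smooth

end UnitaryGroup

end Literature.NumberTheory.Automorphic

end
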